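import Literature.NumberTheory.Transcendental.KZCalculus
import Literature.NumberTheory.Transcendental.KZLogCalculusProofs
import Literature.NumberTheory.Transcendental.KZDominatedFamilyRelations

/-!
# Stub `stub_assembly` — helpers
(crux `BiellipticRealPeriodCell`, stmt-KontsevichZagierPeriods-18685, line `Sketch`, stub ASM,
part 1/2)

Generic helpers for the generatorwise transfer `stub_assembly` of the bielliptic sector
`[K, (a₀ + a₁x)/√G(x²)]` into the real-period cell (i) (file
`IsogenyCertificatesBiellipticRealPeriodCellStubAssembly.lean`):

* the two elementary identities behind the rational maps `φ₁(y) = (y² − s)/m` and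
  `φ₂(y) = (y⁻² − s)/m` onto the integral short Weierstrass models `P(t) = t³ + At + B`:
  `F(y) = k²·P(φ₁ y)` resp. `F(y) = k²y⁶·P(φ₂ y)` (`odd_eval`, `even_eval`), whence end points
  (roots of `F`) go to roots of `P` and `F > 0` goes to `P > 0`;
* `window`: an image `φ((α, β)) = uIoo (φ α) (φ β)` with `P(φ α) = P(φ β) = 0`, `P ∘ φ > 0` is an
  open interval between two roots of `P` on which `P > 0`; the odd/even specialisations
  `odd_window`, `even_window`, and the ray version `even_ray` for a central oval;
* `odd_cancel`: the two odd targets of a central oval have the same domain and opposite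
  integrands, so their sum is a relation (`KZ.of_add_of_mem_relations_of_eqOn_neg`);
* `rule1b`: `[D, (a₀ + a₁x)/√F] − [D, a₀/√F] − [D, a₁x/√F]` is an integrand-additivity relation;
* `split_at_zero`: `[(α, β), f] ≡ [(0, β), f] + [(α, 0), f]` modulo relations for `α ≤ 0 ≤ β`
  (co-null restriction to `(α, β) ∖ {0}`, then domain additivity).

No definitions are introduced; only the KZ moves (1a), (1b) and the congruence/junk lemmas of
`KZLogCalculusProofs` / `KZDominatedFamilyRelations` are used (the file deliberately imports
Literature only, so that it does not depend on the route's Theses file).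

References: M. Kontsevich, D. Zagier, *Periods* (2001), §1.2.
-/

noncomputable section

open Polynomial Set MeasureTheory
open Literature.NumberTheory.Transcendental
open Literature.ModelTheory.ExponentialFields (IsSemialgebraic isSemialgebraic_setOf_eval_pos)

namespace Summit.KontsevichZagierPeriods.IsogenyCertificates.BiellipticRealPeriodCellStubs.Assembly

/-! ### The two model identities -/

/-- Odd map: `m³F(y) = k²((y² − s)³ + Am²(y² − s) + Bm³)` means `F(y) = k²·P((y² − s)/m)`.
[folklore] -/
theorem odd_eval {m s k : ℚ} {A B : ℤ} {y Fy : ℝ} (hm : m ≠ 0)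
    (h : (m : ℝ) ^ 3 * Fy =
      (k : ℝ) ^ 2 * ((y ^ 2 - s) ^ 3 + (A : ℝ) * m ^ 2 * (y ^ 2 - s) + (B : ℝ) * m ^ 3)) :
    Fy = (k : ℝ) ^ 2 *
      (((y ^ 2 - s) / m) ^ 3 + (A : ℝ) * ((y ^ 2 - s) / m) + (B : ℝ)) := by
  have hm' : (m : ℝ) ≠ 0 := by exact_mod_cast hm
  apply mul_left_cancel₀ (pow_ne_zero 3 hm')
  rw [h]
  field_simp

/-- Odd map: a root of `F` goes to a root of `P`. [folklore] -/
theorem odd_root {m s k : ℚ} {A B : ℤ} {y Fy : ℝ} (hm : m ≠ 0) (hk : k ≠ 0)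
    (h : (m : ℝ) ^ 3 * Fy =
      (k : ℝ) ^ 2 * ((y ^ 2 - s) ^ 3 + (A : ℝ) * m ^ 2 * (y ^ 2 - s) + (B : ℝ) * m ^ 3))
    (hFy : Fy = 0) :
    ((y ^ 2 - s) / m) ^ 3 + (A : ℝ) * ((y ^ 2 - s) / m) + (B : ℝ) = 0 := by
  have hk' : (k : ℝ) ^ 2 ≠ 0 := pow_ne_zero 2 (by exact_mod_cast hk)
  have := odd_eval (A := A) (B := B) hm h
  rw [hFy] at this
  exact (mul_eq_zero.mp this.symm).resolve_left hk'

/-- Odd map: `F(y) > 0` forces `P(φ₁ y) > 0`. [folklore] -/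
theorem odd_pos {m s k : ℚ} {A B : ℤ} {y Fy : ℝ} (hm : m ≠ 0) (hk : k ≠ 0)
    (h : (m : ℝ) ^ 3 * Fy =
      (k : ℝ) ^ 2 * ((y ^ 2 - s) ^ 3 + (A : ℝ) * m ^ 2 * (y ^ 2 - s) + (B : ℝ) * m ^ 3))
    (hFy : 0 < Fy) :
    0 < ((y ^ 2 - s) / m) ^ 3 + (A : ℝ) * ((y ^ 2 - s) / m) + (B : ℝ) := by
  have hk' : (k : ℝ) ≠ 0 := by exact_mod_cast hk
  have hk2 : 0 < (k : ℝ) ^ 2 := by positivity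
  rw [odd_eval (A := A) (B := B) hm h] at hFy
  exact (mul_pos_iff_of_pos_left hk2).mp hFy

/-- Even map: `m³F(y) = k²((1 − sy²)³ + Am²y⁴(1 − sy²) + Bm³y⁶)` means, for `y ≠ 0`,
`F(y) = k²y⁶·P((y⁻² − s)/m)`. [folklore] -/
theorem even_eval {m s k : ℚ} {A B : ℤ} {y Fy : ℝ} (hm : m ≠ 0) (hy : y ≠ 0)
    (h : (m : ℝ) ^ 3 * Fy = (k : ℝ) ^ 2 * ((1 - s * y ^ 2) ^ 3 +
      (A : ℝ) * m ^ 2 * y ^ 4 * (1 - s * y ^ 2) + (B : ℝ) * m ^ 3 * y ^ 6)) :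
    Fy = (k : ℝ) ^ 2 * y ^ 6 *
      ((((y ^ 2)⁻¹ - s) / m) ^ 3 + (A : ℝ) * (((y ^ 2)⁻¹ - s) / m) + (B : ℝ)) := by
  have hm' : (m : ℝ) ≠ 0 := by exact_mod_cast hm
  apply mul_left_cancel₀ (pow_ne_zero 3 hm')
  rw [h]
  field_simp

/-- Even map: a nonzero root of `F` goes to a root of `P`. [folklore] -/
theorem even_root {m s k : ℚ} {A B : ℤ} {y Fy : ℝ} (hm : m ≠ 0) (hk : k ≠ 0) (hy : y ≠ 0)
    (h : (m : ℝ) ^ 3 * Fy = (k : ℝ) ^ 2 * ((1 - s * y ^ 2) ^ 3 +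
      (A : ℝ) * m ^ 2 * y ^ 4 * (1 - s * y ^ 2) + (B : ℝ) * m ^ 3 * y ^ 6))
    (hFy : Fy = 0) :
    (((y ^ 2)⁻¹ - s) / m) ^ 3 + (A : ℝ) * (((y ^ 2)⁻¹ - s) / m) + (B : ℝ) = 0 := by
  have hk' : (k : ℝ) ^ 2 * y ^ 6 ≠ 0 :=
    mul_ne_zero (pow_ne_zero 2 (by exact_mod_cast hk)) (pow_ne_zero 6 hy)
  have := even_eval (A := A) (B := B) hm hy h
  rw [hFy] at this
  exact (mul_eq_zero.mp this.symm).resolve_left hk'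

/-- Even map: `F(y) > 0`, `y ≠ 0` forces `P(φ₂ y) > 0`. [folklore] -/
theorem even_pos {m s k : ℚ} {A B : ℤ} {y Fy : ℝ} (hm : m ≠ 0) (hk : k ≠ 0) (hy : y ≠ 0)
    (h : (m : ℝ) ^ 3 * Fy = (k : ℝ) ^ 2 * ((1 - s * y ^ 2) ^ 3 +
      (A : ℝ) * m ^ 2 * y ^ 4 * (1 - s * y ^ 2) + (B : ℝ) * m ^ 3 * y ^ 6))
    (hFy : 0 < Fy) :
    0 < (((y ^ 2)⁻¹ - s) / m) ^ 3 + (A : ℝ) * (((y ^ 2)⁻¹ - s) / m) + (B : ℝ) := by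
  have hk' : (k : ℝ) ≠ 0 := by exact_mod_cast hk
  have hk2 : 0 < (k : ℝ) ^ 2 * y ^ 6 := by positivity
  rw [even_eval (A := A) (B := B) hm hy h] at hFy
  exact (mul_pos_iff_of_pos_left hk2).mp hFy

/-! ### Windows: images of one-signed halves are whole components -/

/-- An image `φ((α, β)) = uIoo (φ α) (φ β)` whose ends are roots of `P` and on which `P ∘ φ > 0`
is an open interval between two roots of `P` on which `P > 0`. [folklore] -/
theorem window (φ P : ℝ → ℝ) {α β : ℝ} (hαβ : α < β)
    (himg : φ '' Ioo α β = uIoo (φ α) (φ β)) (hα : P (φ α) = 0) (hβ : P (φ β) = 0)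
    (hpos : ∀ y ∈ Ioo α β, 0 < P (φ y)) :
    ∃ c d : ℝ, c < d ∧ P c = 0 ∧ P d = 0 ∧ (∀ y ∈ Ioo c d, 0 < P y) ∧ φ '' Ioo α β = Ioo c d := by
  have hne : φ α ≠ φ β := by
    have h : (uIoo (φ α) (φ β)).Nonempty := himg ▸ (nonempty_Ioo.2 hαβ).image φ
    exact nonempty_uIoo.1 h
  have hposI : ∀ y ∈ uIoo (φ α) (φ β), 0 < P y := by
    intro y hy
    rw [← himg] at hy
    obtain ⟨z, hz, rfl⟩ := hy
    exact hpos z hz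
  rcases lt_or_gt_of_ne hne with h | h
  · rw [uIoo_of_lt h] at himg hposI
    exact ⟨φ α, φ β, h, hα, hβ, hposI, himg⟩
  · rw [uIoo_of_gt h] at himg hposI
    exact ⟨φ β, φ α, h, hβ, hα, hposI, himg⟩

/-- **Odd window.** On a one-signed half `(α, β)` between two roots of `F`, on which `F > 0`,
the image `φ₁((α, β))` is an open interval between two roots of `P₁` on which `P₁ > 0`.
[folklore] -/
theorem odd_window {F : ℚ[X]} {m s k : ℚ} {A B : ℤ} {α β : ℝ} (hm : m ≠ 0) (hk : k ≠ 0)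
    (hmod : ∀ y : ℝ, (m : ℝ) ^ 3 * aeval y F =
      (k : ℝ) ^ 2 * ((y ^ 2 - s) ^ 3 + (A : ℝ) * m ^ 2 * (y ^ 2 - s) + (B : ℝ) * m ^ 3))
    (hαβ : α < β) (h0 : 0 ≤ α ∨ β ≤ 0) (hFα : aeval α F = 0) (hFβ : aeval β F = 0)
    (hpos : ∀ y ∈ Ioo α β, 0 < aeval y F)
    (hG1 : ∀ (m s α β : ℝ), m ≠ 0 → α < β → (0 ≤ α ∨ β ≤ 0) →
      (fun y : ℝ => (y ^ 2 - s) / m) '' Ioo α β = uIoo ((α ^ 2 - s) / m) ((β ^ 2 - s) / m)) :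
    ∃ c d : ℝ, c < d ∧ c ^ 3 + (A : ℝ) * c + (B : ℝ) = 0 ∧ d ^ 3 + (A : ℝ) * d + (B : ℝ) = 0 ∧
      (∀ y ∈ Ioo c d, 0 < y ^ 3 + (A : ℝ) * y + (B : ℝ)) ∧
      (fun y : ℝ => (y ^ 2 - (s : ℝ)) / (m : ℝ)) '' Ioo α β = Ioo c d := by
  have hm' : (m : ℝ) ≠ 0 := by exact_mod_cast hm
  obtain ⟨c, d, hcd, hc, hd, hP, himg⟩ := window (fun y : ℝ => (y ^ 2 - (s : ℝ)) / (m : ℝ))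
    (fun t : ℝ => t ^ 3 + (A : ℝ) * t + (B : ℝ)) hαβ (hG1 m s α β hm' hαβ h0)
    (odd_root hm hk (hmod α) hFα) (odd_root hm hk (hmod β) hFβ)
    (fun y hy => odd_pos hm hk (hmod y) (hpos y hy))
  exact ⟨c, d, hcd, hc, hd, hP, himg⟩

/-- **Even window.** On a one-signed half `(α, β)` between two roots of `F` (so `α, β ≠ 0` as
`F(0) ≠ 0`), on which `F > 0`, the image `φ₂((α, β))` is an open interval between two roots of
`P₂` on which `P₂ > 0`. [folklore] -/
theorem even_window {F : ℚ[X]} {m s k : ℚ} {A B : ℤ} {α β : ℝ} (hm : m ≠ 0) (hk : k ≠ 0)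
    (hmod : ∀ y : ℝ, (m : ℝ) ^ 3 * aeval y F = (k : ℝ) ^ 2 * ((1 - s * y ^ 2) ^ 3 +
      (A : ℝ) * m ^ 2 * y ^ 4 * (1 - s * y ^ 2) + (B : ℝ) * m ^ 3 * y ^ 6))
    (hαβ : α < β) (h0 : 0 ≤ α ∨ β ≤ 0) (hFα : aeval α F = 0) (hFβ : aeval β F = 0)
    (hF0 : aeval (0 : ℝ) F ≠ 0) (hpos : ∀ y ∈ Ioo α β, 0 < aeval y F)
    (hG2 : ∀ (m s α β : ℝ), m ≠ 0 → α < β → (0 < α ∨ β < 0) →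
      (fun y : ℝ => ((y ^ 2)⁻¹ - s) / m) '' Ioo α β =
        uIoo (((α ^ 2)⁻¹ - s) / m) (((β ^ 2)⁻¹ - s) / m)) :
    ∃ c d : ℝ, c < d ∧ c ^ 3 + (A : ℝ) * c + (B : ℝ) = 0 ∧ d ^ 3 + (A : ℝ) * d + (B : ℝ) = 0 ∧
      (∀ y ∈ Ioo c d, 0 < y ^ 3 + (A : ℝ) * y + (B : ℝ)) ∧
      (fun y : ℝ => ((y ^ 2)⁻¹ - (s : ℝ)) / (m : ℝ)) '' Ioo α β = Ioo c d := by
  have hm' : (m : ℝ) ≠ 0 := by exact_mod_cast hm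
  have hα0 : α ≠ 0 := fun h => hF0 (h ▸ hFα)
  have hβ0 : β ≠ 0 := fun h => hF0 (h ▸ hFβ)
  have h0' : 0 < α ∨ β < 0 :=
    h0.imp (fun h => lt_of_le_of_ne h (Ne.symm hα0)) (fun h => lt_of_le_of_ne h hβ0)
  have hy0 : ∀ y ∈ Ioo α β, y ≠ 0 := by
    rintro y ⟨h₁, h₂⟩ rfl
    rcases h0' with h | h <;> linarith
  obtain ⟨c, d, hcd, hc, hd, hP, himg⟩ := window (fun y : ℝ => ((y ^ 2)⁻¹ - (s : ℝ)) / (m : ℝ))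
    (fun t : ℝ => t ^ 3 + (A : ℝ) * t + (B : ℝ)) hαβ (hG2 m s α β hm' hαβ h0')
    (even_root hm hk hα0 (hmod α) hFα) (even_root hm hk hβ0 (hmod β) hFβ)
    (fun y hy => even_pos hm hk (hy0 y hy) (hmod y) (hpos y hy))
  exact ⟨c, d, hcd, hc, hd, hP, himg⟩

/-- **Even ray (central oval).** For the symmetric oval `(−β, β) ∋ 0`: `m > 0` (compare
`m³F(0) = k²`), both halves go onto the ray `(φ₂ β, ∞)`, `φ₂ β` is a root of `P₂`, and `P₂ > 0`
on the ray. [folklore] -/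
theorem even_ray {F : ℚ[X]} {m s k : ℚ} {A B : ℤ} {β : ℝ} (hm : m ≠ 0) (hk : k ≠ 0)
    (hmod : ∀ y : ℝ, (m : ℝ) ^ 3 * aeval y F = (k : ℝ) ^ 2 * ((1 - s * y ^ 2) ^ 3 +
      (A : ℝ) * m ^ 2 * y ^ 4 * (1 - s * y ^ 2) + (B : ℝ) * m ^ 3 * y ^ 6))
    (hβ : 0 < β) (hFβ : aeval β F = 0) (hF0 : 0 < aeval (0 : ℝ) F)
    (hpos : ∀ y ∈ Ioo 0 β, 0 < aeval y F)
    (hG3 : ∀ (m s β : ℝ), 0 < m → 0 < β →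
      (fun y : ℝ => ((y ^ 2)⁻¹ - s) / m) '' Ioo 0 β = Ioi (((β ^ 2)⁻¹ - s) / m) ∧
      (fun y : ℝ => ((y ^ 2)⁻¹ - s) / m) '' Ioo (-β) 0 = Ioi (((β ^ 2)⁻¹ - s) / m)) :
    ∃ c : ℝ, c ^ 3 + (A : ℝ) * c + (B : ℝ) = 0 ∧ (∀ y ∈ Ioi c, 0 < y ^ 3 + (A : ℝ) * y + (B : ℝ)) ∧
      (fun y : ℝ => ((y ^ 2)⁻¹ - (s : ℝ)) / (m : ℝ)) '' Ioo 0 β = Ioi c ∧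
      (fun y : ℝ => ((y ^ 2)⁻¹ - (s : ℝ)) / (m : ℝ)) '' Ioo (-β) 0 = Ioi c := by
  have hk' : (k : ℝ) ≠ 0 := by exact_mod_cast hk
  have hm3 : 0 < (m : ℝ) ^ 3 := by
    have h := hmod 0
    have h' : (m : ℝ) ^ 3 * aeval (0 : ℝ) F = (k : ℝ) ^ 2 := by
      rw [h]; ring
    have hk2 : 0 < (k : ℝ) ^ 2 := by positivity
    exact (mul_pos_iff_of_pos_right hF0).mp (h' ▸ hk2)
  have hmpos : 0 < (m : ℝ) := (Odd.pow_pos_iff (by decide : Odd 3)).mp hm3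
  obtain ⟨hp, hn⟩ := hG3 m s β hmpos hβ
  refine ⟨((β ^ 2)⁻¹ - (s : ℝ)) / (m : ℝ), even_root hm hk hβ.ne' (hmod β) hFβ, ?_, hp, hn⟩
  intro y hy
  rw [← hp] at hy
  obtain ⟨z, hz, rfl⟩ := hy
  exact even_pos hm hk hz.1.ne' (hmod z) (hpos z hz)

/-! ### Cancellation of the odd targets of a central oval -/

/-- The two odd targets of a central oval `(−β, β)`: `φ₁((0, β)) = φ₁((−β, 0))`, and the
integrands `±(a₁|m|/2|k|)/√P₁` are opposite, so `[tp] + [tn]` is a relation.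
[Kontsevich–Zagier 2001, §1.2, rule (1)] -/
theorem odd_cancel {m s k a₁ : ℚ} {A B : ℤ} {β : ℝ} (hm : m ≠ 0) (hβ : 0 < β)
    (hG1 : ∀ (m s α β : ℝ), m ≠ 0 → α < β → (0 ≤ α ∨ β ≤ 0) →
      (fun y : ℝ => (y ^ 2 - s) / m) '' Ioo α β = uIoo ((α ^ 2 - s) / m) ((β ^ 2 - s) / m))
    {tp tn : KZ.IntegralRep 1}
    (htpd : tp.domain = {x | x 0 ∈ (fun y : ℝ => (y ^ 2 - s) / m) '' Ioo 0 β})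
    (htpi : EqOn tp.integrand (fun x => ((1 * a₁ * |m| / (2 * |k|) : ℚ) : ℝ) /
      Real.sqrt (x 0 ^ 3 + (A : ℝ) * x 0 + (B : ℝ))) tp.domain)
    (htnd : tn.domain = {x | x 0 ∈ (fun y : ℝ => (y ^ 2 - s) / m) '' Ioo (-β) 0})
    (htni : EqOn tn.integrand (fun x => ((-1 * a₁ * |m| / (2 * |k|) : ℚ) : ℝ) /
      Real.sqrt (x 0 ^ 3 + (A : ℝ) * x 0 + (B : ℝ))) tn.domain) :
    KZ.of tp + KZ.of tn ∈ KZ.relations := by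
  have hm' : (m : ℝ) ≠ 0 := by exact_mod_cast hm
  have hp := hG1 m s 0 β hm' hβ (Or.inl le_rfl)
  have hn := hG1 m s (-β) 0 hm' (by linarith) (Or.inr le_rfl)
  rw [neg_sq, uIoo_comm] at hn
  have hd : tn.domain = tp.domain := by rw [htnd, htpd, hp, hn]
  refine KZ.of_add_of_mem_relations_of_eqOn_neg hd fun x hx => ?_
  rw [Pi.neg_apply, htpi hx, htni (hd ▸ hx)]
  push_cast
  ring

/-! ### Rule (1b): odd/even parts -/

/-- `[D, (a₀ + a₁x)/√F] − [D, a₀/√F] − [D, a₁x/√F]` is an integrand-additivity relation.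
[Kontsevich–Zagier 2001, §1.2, rule (1)] -/
theorem rule1b {F : ℚ[X]} {a₀ a₁ : ℚ} {D : Set (Fin 1 → ℝ)} (r O E : KZ.IntegralRep 1)
    (hr : r.domain = D)
    (hint : EqOn r.integrand
      (fun x => ((a₀ : ℝ) + (a₁ : ℝ) * x 0) / Real.sqrt (aeval (x 0) F)) r.domain)
    (hO : O.domain = D) (hOi : O.integrand = fun x => (a₁ : ℝ) * x 0 / Real.sqrt (aeval (x 0) F))
    (hE : E.domain = D) (hEi : E.integrand = fun x => (a₀ : ℝ) / Real.sqrt (aeval (x 0) F)) :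
    KZ.of r - KZ.of E - KZ.of O ∈ KZ.relations :=
  KZ.integrandAddRel_subset_relations ⟨1, r, E, O, hE.trans hr.symm, hO.trans hr.symm,
    fun x hx => by rw [hint hx, Pi.add_apply, hEi, hOi]; simp only [add_div], rfl⟩

/-! ### Rule (1a): splitting an interval at `0` -/

/-- **Splitting at `0`.** A representation on `(α, β)` with `α ≤ 0 ≤ β` is congruent modulo
relations to the sum of its restrictions to `(0, β)` and `(α, 0)`: restrict to the co-null
`(α, β) ∖ {0}` (`KZ.IntegralRep.of_sub_of_restrict_mem_relations`), then domain additivity.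
[Kontsevich–Zagier 2001, §1.2, rule (1)] -/
theorem split_at_zero (r : KZ.IntegralRep 1) {α β : ℝ} (hα : α ≤ 0) (hβ : 0 ≤ β)
    (hdom : r.domain = {x | x 0 ∈ Ioo α β}) :
    ∃ rp rn : KZ.IntegralRep 1,
      rp.domain = {x | x 0 ∈ Ioo 0 β} ∧ rn.domain = {x | x 0 ∈ Ioo α 0} ∧
      rp.integrand = r.integrand ∧ rn.integrand = r.integrand ∧
      rp.domain ⊆ r.domain ∧ rn.domain ⊆ r.domain ∧
      KZ.of r - KZ.of rp - KZ.of rn ∈ KZ.relations := by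
  -- the two open half-lines of `ℝ¹` are `ℚ`-semialgebraic (`0 < X 0`, `0 < -X 0`)
  have hpos_sa : IsSemialgebraic ℚ {x : Fin 1 → ℝ | 0 < x 0} := by
    convert isSemialgebraic_setOf_eval_pos (k := ℚ) (R := ℝ)
      (MvPolynomial.X 0 : MvPolynomial (Fin 1) ℚ) using 1
    ext x; simp
  have hneg_sa : IsSemialgebraic ℚ {x : Fin 1 → ℝ | x 0 < 0} := by
    convert isSemialgebraic_setOf_eval_pos (k := ℚ) (R := ℝ)
      (-MvPolynomial.X 0 : MvPolynomial (Fin 1) ℚ) using 1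
    ext x; simp
  have hHp : {x : Fin 1 → ℝ | x 0 ∈ Ioo 0 β} = r.domain ∩ {x | 0 < x 0} := by
    ext x
    simp only [hdom, mem_setOf_eq, mem_inter_iff, mem_Ioo]
    constructor
    · rintro ⟨h₁, h₂⟩; exact ⟨⟨by linarith, h₂⟩, h₁⟩
    · rintro ⟨⟨-, h₂⟩, h₃⟩; exact ⟨h₃, h₂⟩
  have hHn : {x : Fin 1 → ℝ | x 0 ∈ Ioo α 0} = r.domain ∩ {x | x 0 < 0} := by
    ext x
    simp only [hdom, mem_setOf_eq, mem_inter_iff, mem_Ioo]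
    constructor
    · rintro ⟨h₁, h₂⟩; exact ⟨⟨h₁, by linarith⟩, h₂⟩
    · rintro ⟨⟨h₁, -⟩, h₃⟩; exact ⟨h₁, h₃⟩
  have hsap : IsSemialgebraic ℚ {x : Fin 1 → ℝ | x 0 ∈ Ioo 0 β} := by
    rw [hHp]; exact r.isSemialgebraic_domain.inter hpos_sa
  have hsan : IsSemialgebraic ℚ {x : Fin 1 → ℝ | x 0 ∈ Ioo α 0} := by
    rw [hHn]; exact r.isSemialgebraic_domain.inter hneg_sa
  have hsubp : {x : Fin 1 → ℝ | x 0 ∈ Ioo 0 β} ⊆ r.domain := by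
    rw [hHp]; exact inter_subset_left
  have hsubn : {x : Fin 1 → ℝ | x 0 ∈ Ioo α 0} ⊆ r.domain := by
    rw [hHn]; exact inter_subset_left
  have hEsa :
      IsSemialgebraic ℚ ({x : Fin 1 → ℝ | x 0 ∈ Ioo 0 β} ∪ {x : Fin 1 → ℝ | x 0 ∈ Ioo α 0}) :=
    hsap.union hsan
  have hEsub : {x : Fin 1 → ℝ | x 0 ∈ Ioo 0 β} ∪ {x : Fin 1 → ℝ | x 0 ∈ Ioo α 0} ⊆ r.domain :=
    union_subset hsubp hsubn
  have hvol : volume (r.domain \ ({x : Fin 1 → ℝ | x 0 ∈ Ioo 0 β} ∪ {x | x 0 ∈ Ioo α 0})) = 0 := by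
    -- the difference lies in the point `{0} ⊆ ℝ¹`
    refine measure_mono_null (fun x hx => ?_) (measure_singleton (0 : Fin 1 → ℝ))
    simp only [hdom, mem_sdiff, mem_union, mem_setOf_eq, mem_Ioo, not_or] at hx
    obtain ⟨⟨h₁, h₂⟩, h₃, h₄⟩ := hx
    have hx0 : x 0 = 0 := by
      by_contra hne
      rcases lt_or_gt_of_ne hne with h | h
      · exact h₄ ⟨h₁, h⟩
      · exact h₃ ⟨h, h₂⟩
    exact mem_singleton_iff.2 (funext fun i => by rw [Subsingleton.elim i 0, hx0]; rfl)
  have hrel₁ := r.of_sub_of_restrict_mem_relations hEsa hEsub hvol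
  have hadd : KZ.of (r.restrict _ hEsa hEsub) - KZ.of (r.restrict _ hsap hsubp) -
      KZ.of (r.restrict _ hsan hsubn) ∈ KZ.domainAddRel := by
    refine ⟨1, r.restrict _ hEsa hEsub, r.restrict _ hsap hsubp, r.restrict _ hsan hsubn, rfl, ?_,
      fun _ _ => rfl, fun _ _ => rfl, rfl⟩
    have : (r.restrict _ hsap hsubp).domain ∩ (r.restrict _ hsan hsubn).domain = ∅ :=
      eq_empty_of_forall_notMem fun x hx => by
        simp only [KZ.IntegralRep.domain_restrict, mem_inter_iff, mem_setOf_eq, mem_Ioo] at hx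
        linarith [hx.1.1, hx.2.2]
    rw [this, measure_empty]
  refine ⟨r.restrict _ hsap hsubp, r.restrict _ hsan hsubn, rfl, rfl, rfl, rfl, hsubp, hsubn, ?_⟩
  have : KZ.of r - KZ.of (r.restrict _ hsap hsubp) - KZ.of (r.restrict _ hsan hsubn) =
      (KZ.of r - KZ.of (r.restrict _ hEsa hEsub)) + (KZ.of (r.restrict _ hEsa hEsub) -
        KZ.of (r.restrict _ hsap hsubp) - KZ.of (r.restrict _ hsan hsubn)) := by
    abel
  rw [this]
  exact add_mem hrel₁ (KZ.domainAddRel_subset_relations hadd)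

/-! ### Registered form -/

/-- **Registered helper stub `stub_assembly_splitAtZero`** (serves `stub_assembly`; registered on
the crux item so that this helper file lands under `--supports`): `split_at_zero` in closed form —
a representation on `(α, β)` with `α ≤ 0 ≤ β` is congruent modulo `KZ.relations` to the sum of its
restrictions to `(0, β)` and `(α, 0)`. [Kontsevich–Zagier 2001, §1.2, rule (1)] -/
theorem stub_assembly_splitAtZero : ∀ (r : Literature.NumberTheory.Transcendental.KZ.IntegralRep 1) (α β : ℝ), α ≤ 0 → 0 ≤ β → r.domain = {x | x 0 ∈ Set.Ioo α β} → ∃ rp rn : Literature.NumberTheory.Transcendental.KZ.IntegralRep 1, rp.domain = {x | x 0 ∈ Set.Ioo 0 β} ∧ rn.domain = {x | x 0 ∈ Set.Ioo α 0} ∧ rp.integrand = r.integrand ∧ rn.integrand = r.integrand ∧ rp.domain ⊆ r.domain ∧ rn.domain ⊆ r.domain ∧ Literature.NumberTheory.Transcendental.KZ.of r - Literature.NumberTheory.Transcendental.KZ.of rp - Literature.NumberTheory.Transcendental.KZ.of rn ∈ Literature.NumberTheory.Transcendental.KZ.relations :=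
  fun r _ _ hα hβ hdom => split_at_zero r hα hβ hdom

end Summit.KontsevichZagierPeriods.IsogenyCertificates.BiellipticRealPeriodCellStubs.Assembly

end
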